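import Summits.Ventures.PercRepro.S2TwoAvoidingCircuits
import Summits.Ventures.PercRepro.S2CircuitNullity

/-!
# PercRepro — S2: TOOLS FOR THE ROWS `t = 7, 8` OF THE SPREAD CASE OF `(14, 7)` (p7, gen 14; sub-claim S2)

* **`not_subset_closure_of_ncard_le_seven`** — on a spread core no set `P` of `≤ 7` points and nullity `≥ 2` avoiding a
  triangle `T` has `T ⊆ cl P`: `P ∪ (T ∖ p)` would be a set of `≤ 9` points of nullity `≥ 4`.
* **`exists_two_points_four_circuits_of_six_le`** — when the triangles outnumber the avoiding ones by `≥ 6`, two points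
  `u ≠ v` of `T` carry two further triangles each; their quadruples `Q_u`, `Q_v` are `4`-circuits avoiding `T` with
  `u ∈ cl Q_u`, `v ∈ cl Q_v`.
* **`forall_exists_four_circuit_of_seven_le`** — outnumbered by `≥ 7`, EVERY point of `T` carries such a quadruple.
* **`triangle_subset_closure_of_two_mem`** — a triangle lies in the closure of any set spanning two of its points.
Axioms: standard.
-/

open scoped Matroid

namespace PercRepro

namespace S2

open Set

variable {α : Type}

/-- **A small avoiding set of nullity `≥ 2` does not span a triangle** on a spread core. -/
theorem not_subset_closure_of_ncard_le_seven (M : Matroid α) [M.Finite]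
    (h9 : ∀ X ⊆ M.E, X.ncard ≤ 9 → X.encard ≤ M.eRk X + 3)
    {T P : Set α} (hT : M.IsCircuit T) (hT3 : T.ncard = 3) (hP : P ⊆ M.E) (hPT : Disjoint P T)
    (hP7 : P.ncard ≤ 7) (hP2 : M.eRk P + 2 ≤ P.encard) (hTP : T ⊆ M.closure P) : False := by
  have hPfin : P.Finite := M.ground_finite.subset hP
  have hTfin : T.Finite := M.ground_finite.subset hT.subset_ground
  obtain ⟨p, hp⟩ := hT.nonempty
  -- the set `S = P ∪ (T ∖ {p})`: `|P| + 2` points, rank `≤ ρ P`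
  have hSE : P ∪ (T \ {p}) ⊆ M.E := Set.union_subset hP (Set.sdiff_subset.trans hT.subset_ground)
  have hSfin : (P ∪ (T \ {p})).Finite := hPfin.union (hTfin.subset Set.sdiff_subset)
  have hScard : (P ∪ (T \ {p})).ncard = P.ncard + 2 := by
    rw [Set.ncard_union_eq (hPT.mono_right Set.sdiff_subset) hPfin (hTfin.subset Set.sdiff_subset)]
    have := Set.ncard_sdiff_singleton_add_one hp hTfin
    omega
  have hSrk : M.eRk (P ∪ (T \ {p})) ≤ M.eRk P := by
    calc M.eRk (P ∪ (T \ {p})) ≤ M.eRk (M.closure P) :=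
          M.eRk_mono (Set.union_subset (M.subset_closure P hP) (Set.sdiff_subset.trans hTP))
      _ = M.eRk P := M.eRk_closure_eq P
  have h := h9 _ hSE (by omega)
  rw [← hSfin.cast_ncard_eq, hScard] at h
  rw [← hPfin.cast_ncard_eq] at hP2
  obtain ⟨r, hr⟩ := ENat.ne_top_iff_exists.1 (eRk_ne_top_of_finite (M := M) hP)
  obtain ⟨r', hr'⟩ := ENat.ne_top_iff_exists.1 (eRk_ne_top_of_finite (M := M) hSE)
  rw [← hr] at hP2 hSrk
  rw [← hr'] at h hSrk
  have h1 : P.ncard + 2 ≤ r' + 3 := by exact_mod_cast h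
  have h2 : r + 2 ≤ P.ncard := by exact_mod_cast hP2
  have h3 : r' ≤ r := by exact_mod_cast hSrk
  omega

/-- **A triangle lies in the closure of any set spanning two of its points.** -/
theorem triangle_subset_closure_of_two_mem (M : Matroid α) [M.Finite]
    {T : Set α} (hT : M.IsCircuit T) (hT3 : T.ncard = 3) {u v : α} (hu : u ∈ T) (hv : v ∈ T) (huv : u ≠ v)
    {P : Set α} (huP : u ∈ M.closure P) (hvP : v ∈ M.closure P) : T ⊆ M.closure P := by
  have hline : M.closure {u, v} ⊆ M.closure P :=
    M.closure_subset_closure_of_subset_closure (Set.insert_subset huP (Set.singleton_subset_iff.2 hvP))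
  intro w hw
  by_cases hwu : w = u
  · exact hwu ▸ huP
  by_cases hwv : w = v
  · exact hwv ▸ hvP
  have hsub : T \ {w} ⊆ {u, v} := by
    obtain ⟨a, b, c, hab, hac, hbc, hTabc⟩ := Set.ncard_eq_three.1 hT3
    intro y ⟨hyT, hyw⟩
    have hyw' : y ≠ w := fun h => hyw (Set.mem_singleton_iff.2 h)
    rw [hTabc] at hyT hw hu hv
    simp only [Set.mem_insert_iff, Set.mem_singleton_iff] at hyT hw hu hv ⊢
    rcases hyT with rfl | rfl | rfl <;> rcases hw with rfl | rfl | rfl <;>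
      rcases hu with rfl | rfl | rfl <;> rcases hv with rfl | rfl | rfl <;> simp_all
  exact hline (M.closure_mono hsub (hT.mem_closure_sdiff_singleton_of_mem hw))

/-- The through-families of a triangle: with the avoiding triangles outnumbered by `k + 1`, the three points of `T` carry
`≥ k` further triangles in total (each point at most `2`). -/
theorem exists_points_through_of_le (M : Matroid α) [M.Finite]
    (hC1 : ∀ L ⊆ M.E, M.eRk L = 2 → L.ncard ≤ 3)
    (h9 : ∀ X ⊆ M.E, X.ncard ≤ 9 → X.encard ≤ M.eRk X + 3)
    {T : Set α} (hT : M.IsCircuit T) (hT3 : T.ncard = 3) (k : ℕ)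
    (hk : {C : Set α | M.IsCircuit C ∧ C.ncard = 3 ∧ Disjoint C T}.ncard + k + 1 ≤
      {C : Set α | M.IsCircuit C ∧ C.ncard = 3}.ncard) :
    ∃ x y z : α, x ≠ y ∧ x ≠ z ∧ y ≠ z ∧ T = {x, y, z} ∧
      ({T' : Set α | (M.IsCircuit T' ∧ T'.ncard = 3) ∧ T' ≠ T ∧ x ∈ T'}).ncard ≤ 2 ∧
      ({T' : Set α | (M.IsCircuit T' ∧ T'.ncard = 3) ∧ T' ≠ T ∧ y ∈ T'}).ncard ≤ 2 ∧
      ({T' : Set α | (M.IsCircuit T' ∧ T'.ncard = 3) ∧ T' ≠ T ∧ z ∈ T'}).ncard ≤ 2 ∧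
      k ≤ ({T' : Set α | (M.IsCircuit T' ∧ T'.ncard = 3) ∧ T' ≠ T ∧ x ∈ T'}).ncard +
        ({T' : Set α | (M.IsCircuit T' ∧ T'.ncard = 3) ∧ T' ≠ T ∧ y ∈ T'}).ncard +
        ({T' : Set α | (M.IsCircuit T' ∧ T'.ncard = 3) ∧ T' ≠ T ∧ z ∈ T'}).ncard := by
  classical
  set 𝒯 := {C : Set α | M.IsCircuit C ∧ C.ncard = 3} with h𝒯
  have h𝒯fin : 𝒯.Finite := M.ground_finite.finite_subsets.subset (fun C hC => hC.1.subset_ground)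
  set 𝒟 := {C : Set α | M.IsCircuit C ∧ C.ncard = 3 ∧ Disjoint C T} with h𝒟
  have h𝒟fin : 𝒟.Finite := h𝒯fin.subset (fun C hC => ⟨hC.1, hC.2.1⟩)
  have hfinS : ∀ w : α, ({T' ∈ 𝒯 | T' ≠ T ∧ w ∈ T'} : Set (Set α)).Finite :=
    fun _ => h𝒯fin.subset (fun C hC => hC.1)
  have hthrough : ∀ u ∈ T, ({T' ∈ 𝒯 | T' ≠ T ∧ u ∈ T'} : Set (Set α)).ncard ≤ 2 := by
    intro u huT
    by_contra hlt
    push Not at hlt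
    obtain ⟨T₂, T₃, T₄, h2, h3, h4, h23, h24, h34⟩ := (Set.two_lt_ncard_iff (hfinS u)).1 hlt
    exact not_four_triangles_through M hC1 h9 hT hT3 huT h2.1.1 h2.1.2 h2.2.2 h3.1.1 h3.1.2 h3.2.2
      h4.1.1 h4.1.2 h4.2.2 (Ne.symm h2.2.1) (Ne.symm h3.2.1) (Ne.symm h4.2.1) h23 h24 h34
  obtain ⟨x, y, z, hxy, hxz, hyz, hTxyz⟩ := Set.ncard_eq_three.1 hT3
  have hxT : x ∈ T := by rw [hTxyz]; exact Set.mem_insert x _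
  have hyT : y ∈ T := by rw [hTxyz]; exact Set.mem_insert_of_mem x (Set.mem_insert y _)
  have hzT : z ∈ T := by
    rw [hTxyz]; exact Set.mem_insert_of_mem x (Set.mem_insert_of_mem y (Set.mem_singleton z))
  set Sx := ({T' ∈ 𝒯 | T' ≠ T ∧ x ∈ T'} : Set (Set α)) with hSx
  set Sy := ({T' ∈ 𝒯 | T' ≠ T ∧ y ∈ T'} : Set (Set α)) with hSy
  set Sz := ({T' ∈ 𝒯 | T' ≠ T ∧ z ∈ T'} : Set (Set α)) with hSz
  have hcover : 𝒯 ⊆ ({T} ∪ ((Sx ∪ Sy) ∪ Sz)) ∪ 𝒟 := by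
    intro T' hT'
    by_cases hne : T' = T
    · exact Or.inl (Or.inl (Set.mem_singleton_iff.2 hne))
    by_cases hdis : Disjoint T' T
    · exact Or.inr ⟨hT'.1, hT'.2, hdis⟩
    · rw [Set.not_disjoint_iff] at hdis
      obtain ⟨w, hwT', hwT⟩ := hdis
      rw [hTxyz] at hwT
      simp only [Set.mem_insert_iff, Set.mem_singleton_iff] at hwT
      rcases hwT with rfl | rfl | rfl
      · exact Or.inl (Or.inr (Or.inl (Or.inl ⟨hT', hne, hwT'⟩)))
      · exact Or.inl (Or.inr (Or.inl (Or.inr ⟨hT', hne, hwT'⟩)))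
      · exact Or.inl (Or.inr (Or.inr ⟨hT', hne, hwT'⟩))
  have hle := Set.ncard_le_ncard hcover
    (((Set.finite_singleton T).union (((hfinS x).union (hfinS y)).union (hfinS z))).union h𝒟fin)
  have hu1 := Set.ncard_union_le ({T} ∪ ((Sx ∪ Sy) ∪ Sz)) 𝒟
  have hu2 := Set.ncard_union_le ({T} : Set (Set α)) ((Sx ∪ Sy) ∪ Sz)
  have hu3 := Set.ncard_union_le (Sx ∪ Sy) Sz
  have hu4 := Set.ncard_union_le Sx Sy
  rw [Set.ncard_singleton] at hu2
  have hx2 : Sx.ncard ≤ 2 := hthrough x hxT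
  have hy2 : Sy.ncard ≤ 2 := hthrough y hyT
  have hz2 : Sz.ncard ≤ 2 := hthrough z hzT
  refine ⟨x, y, z, hxy, hxz, hyz, hTxyz, hx2, hy2, hz2, ?_⟩
  show k ≤ Sx.ncard + Sy.ncard + Sz.ncard
  omega

/-- A point of `T` carrying two further triangles has a `4`-circuit avoiding `T` in whose closure it lies. -/
theorem exists_four_circuit_of_two_le (M : Matroid α) [M.Finite]
    (hC1 : ∀ L ⊆ M.E, M.eRk L = 2 → L.ncard ≤ 3)
    (hs : ∀ e ∈ M.E, ∀ f ∈ M.E, e ≠ f → M.eRk {e, f} = 2)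
    {T : Set α} (hT : M.IsCircuit T) (hT3 : T.ncard = 3) {u : α} (hu : u ∈ T)
    (h2 : 2 ≤ ({T' : Set α | (M.IsCircuit T' ∧ T'.ncard = 3) ∧ T' ≠ T ∧ u ∈ T'}).ncard) :
    ∃ Q : Set α, M.IsCircuit Q ∧ Q.ncard = 4 ∧ Disjoint Q T ∧ u ∈ M.closure Q := by
  have hfin : ({T' : Set α | (M.IsCircuit T' ∧ T'.ncard = 3) ∧ T' ≠ T ∧ u ∈ T'}).Finite :=
    M.ground_finite.finite_subsets.subset (fun C hC => hC.1.1.subset_ground)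
  obtain ⟨T', T'', hT', hT'', hne⟩ := (Set.one_lt_ncard_iff hfin).1 (by omega)
  exact exists_four_circuit_of_two_triangles_through M hC1 hs hT hT3 hT'.1.1 hT'.1.2 hT''.1.1 hT''.1.2
    hT'.2.1 hT''.2.1 hne hu hT'.2.2 hT''.2.2

/-- **Two points of `T` with their quadruples** when the triangles outnumber the avoiding ones by `≥ 6`. -/
theorem exists_two_points_four_circuits_of_six_le (M : Matroid α) [M.Finite]
    (hC1 : ∀ L ⊆ M.E, M.eRk L = 2 → L.ncard ≤ 3)
    (hs : ∀ e ∈ M.E, ∀ f ∈ M.E, e ≠ f → M.eRk {e, f} = 2)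
    (h9 : ∀ X ⊆ M.E, X.ncard ≤ 9 → X.encard ≤ M.eRk X + 3)
    {T : Set α} (hT : M.IsCircuit T) (hT3 : T.ncard = 3)
    (hk : {C : Set α | M.IsCircuit C ∧ C.ncard = 3 ∧ Disjoint C T}.ncard + 6 ≤
      {C : Set α | M.IsCircuit C ∧ C.ncard = 3}.ncard) :
    ∃ u ∈ T, ∃ v ∈ T, u ≠ v ∧ ∃ Qu Qv : Set α, M.IsCircuit Qu ∧ Qu.ncard = 4 ∧ Disjoint Qu T ∧ u ∈ M.closure Qu ∧
      M.IsCircuit Qv ∧ Qv.ncard = 4 ∧ Disjoint Qv T ∧ v ∈ M.closure Qv := by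
  obtain ⟨x, y, z, hxy, hxz, hyz, hTxyz, hx2, hy2, hz2, hsum⟩ :=
    exists_points_through_of_le M hC1 h9 hT hT3 5 (by omega)
  have hxT : x ∈ T := by rw [hTxyz]; exact Set.mem_insert x _
  have hyT : y ∈ T := by rw [hTxyz]; exact Set.mem_insert_of_mem x (Set.mem_insert y _)
  have hzT : z ∈ T := by
    rw [hTxyz]; exact Set.mem_insert_of_mem x (Set.mem_insert_of_mem y (Set.mem_singleton z))
  have key : ∀ u ∈ T, ∀ v ∈ T, u ≠ v →
      2 ≤ ({T' : Set α | (M.IsCircuit T' ∧ T'.ncard = 3) ∧ T' ≠ T ∧ u ∈ T'}).ncard →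
      2 ≤ ({T' : Set α | (M.IsCircuit T' ∧ T'.ncard = 3) ∧ T' ≠ T ∧ v ∈ T'}).ncard →
      ∃ u ∈ T, ∃ v ∈ T, u ≠ v ∧ ∃ Qu Qv : Set α, M.IsCircuit Qu ∧ Qu.ncard = 4 ∧ Disjoint Qu T ∧ u ∈ M.closure Qu ∧
        M.IsCircuit Qv ∧ Qv.ncard = 4 ∧ Disjoint Qv T ∧ v ∈ M.closure Qv := by
    intro u hu v hv huv h2u h2v
    obtain ⟨Qu, hQu, hQu4, hQuT, huQ⟩ := exists_four_circuit_of_two_le M hC1 hs hT hT3 hu h2u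
    obtain ⟨Qv, hQv, hQv4, hQvT, hvQ⟩ := exists_four_circuit_of_two_le M hC1 hs hT hT3 hv h2v
    exact ⟨u, hu, v, hv, huv, Qu, Qv, hQu, hQu4, hQuT, huQ, hQv, hQv4, hQvT, hvQ⟩
  rcases (by omega : (2 ≤ ({T' : Set α | (M.IsCircuit T' ∧ T'.ncard = 3) ∧ T' ≠ T ∧ x ∈ T'}).ncard ∧
      2 ≤ ({T' : Set α | (M.IsCircuit T' ∧ T'.ncard = 3) ∧ T' ≠ T ∧ y ∈ T'}).ncard) ∨
      (2 ≤ ({T' : Set α | (M.IsCircuit T' ∧ T'.ncard = 3) ∧ T' ≠ T ∧ x ∈ T'}).ncard ∧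
      2 ≤ ({T' : Set α | (M.IsCircuit T' ∧ T'.ncard = 3) ∧ T' ≠ T ∧ z ∈ T'}).ncard) ∨
      (2 ≤ ({T' : Set α | (M.IsCircuit T' ∧ T'.ncard = 3) ∧ T' ≠ T ∧ y ∈ T'}).ncard ∧
      2 ≤ ({T' : Set α | (M.IsCircuit T' ∧ T'.ncard = 3) ∧ T' ≠ T ∧ z ∈ T'}).ncard)) with
    ⟨ha, hb⟩ | ⟨ha, hc⟩ | ⟨hb, hc⟩
  · exact key x hxT y hyT hxy ha hb
  · exact key x hxT z hzT hxz ha hc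
  · exact key y hyT z hzT hyz hb hc

/-- **Every point of `T` has its quadruple** when the triangles outnumber the avoiding ones by `≥ 7`. -/
theorem forall_exists_four_circuit_of_seven_le (M : Matroid α) [M.Finite]
    (hC1 : ∀ L ⊆ M.E, M.eRk L = 2 → L.ncard ≤ 3)
    (hs : ∀ e ∈ M.E, ∀ f ∈ M.E, e ≠ f → M.eRk {e, f} = 2)
    (h9 : ∀ X ⊆ M.E, X.ncard ≤ 9 → X.encard ≤ M.eRk X + 3)
    {T : Set α} (hT : M.IsCircuit T) (hT3 : T.ncard = 3)
    (hk : {C : Set α | M.IsCircuit C ∧ C.ncard = 3 ∧ Disjoint C T}.ncard + 7 ≤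
      {C : Set α | M.IsCircuit C ∧ C.ncard = 3}.ncard) :
    ∀ u ∈ T, ∃ Q : Set α, M.IsCircuit Q ∧ Q.ncard = 4 ∧ Disjoint Q T ∧ u ∈ M.closure Q := by
  obtain ⟨x, y, z, -, -, -, hTxyz, hx2, hy2, hz2, hsum⟩ :=
    exists_points_through_of_le M hC1 h9 hT hT3 6 (by omega)
  intro u hu
  rw [hTxyz] at hu
  simp only [Set.mem_insert_iff, Set.mem_singleton_iff] at hu
  have hxT : x ∈ T := by rw [hTxyz]; exact Set.mem_insert x _
  have hyT : y ∈ T := by rw [hTxyz]; exact Set.mem_insert_of_mem x (Set.mem_insert y _)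
  have hzT : z ∈ T := by
    rw [hTxyz]; exact Set.mem_insert_of_mem x (Set.mem_insert_of_mem y (Set.mem_singleton z))
  rcases hu with rfl | rfl | rfl
  · exact exists_four_circuit_of_two_le M hC1 hs hT hT3 hxT (by omega)
  · exact exists_four_circuit_of_two_le M hC1 hs hT hT3 hyT (by omega)
  · exact exists_four_circuit_of_two_le M hC1 hs hT hT3 hzT (by omega)

end S2

end PercRepro
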